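import Summits.Ventures.HodgeRepro2.Orientation

/-!
# T5Splits — which vertices of the tetrahedron contain a given embedding (support for N0, S1.4)

For the odd tetrahedron `parityTetrahedron K τ` (vertices `0 = 111 = {τ₁,τ₂,τ₃}`, `1 = 100`,
`2 = 010`, `3 = 001`; T4-B4 Prop. B4.5(a)), T5-SUPPORT-p1.md S1.1/S1.4 uses: the embedding `τ_ν`
lies in the vertex `0` and in the vertex `ν + 1` and in no other; its conjugate `τ̄_ν` lies in the
two remaining vertices.  So at `σ = τ_ν` exactly the vertex forms of `111` and of the vertex
`ν + 1` are `(1,0)` (Lemma A0.5), the other two `(0,1)`: the three embeddings `τ₁, τ₂, τ₃` give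
the three SPLITS of the tetrahedron into two pairs — `{111,100}|{010,001}` at `τ₁`,
`{111,010}|{100,001}` at `τ₂`, `{111,001}|{100,010}` at `τ₃` — and `τ̄_ν` gives the same split with
the roles of `(1,0)` and `(0,1)` exchanged.  This refines `isWeilFace_parityTetrahedron` (every
embedding lies in exactly two vertices) by naming the two vertices.
-/

namespace Summit.Ventures.HodgeRepro2

open NumberField ComplexEmbedding

variable {K : Type*} [Field K] (τ : Fin 3 → K →+* ℂ)

/-- The conjugate of an embedding of the CM type `range τ` is not in `range τ`. -/
theorem conjugate_notMem_range (hcm : IsCMType K (Set.range τ)) (ν : Fin 3) :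
    conjugate (τ ν) ∉ Set.range τ := by
  rcases hcm (τ ν) with ⟨_, hc⟩ | ⟨_, ha⟩
  · exact hc
  · exact absurd ⟨ν, rfl⟩ ha

/-- `τ_ν` is never equal to a conjugate `τ̄_ν′`. -/
theorem ne_conjugate (hcm : IsCMType K (Set.range τ)) (ν ν' : Fin 3) : τ ν ≠ conjugate (τ ν') := by
  intro h
  apply conjugate_notMem_range τ hcm ν'
  rw [← h]
  exact ⟨ν, rfl⟩

/-- Every `τ_ν` lies in the vertex `0 = 111`. -/
theorem mem_parityTetrahedron_zero (ν : Fin 3) : τ ν ∈ parityTetrahedron K τ 0 :=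
  ⟨ν, by simp⟩

/-- `τ_ν` lies in the vertex `i + 1` (`i = 0, 1, 2` ↔ `100, 010, 001`) iff `i = ν`. -/
theorem mem_parityTetrahedron_succ_iff (hinj : Function.Injective τ)
    (hcm : IsCMType K (Set.range τ)) (i ν : Fin 3) :
    τ ν ∈ parityTetrahedron K τ i.succ ↔ i = ν := by
  simp only [parityTetrahedron, Set.mem_range, Fin.succ_ne_zero, false_or, Fin.val_succ,
    add_left_inj]
  constructor
  · rintro ⟨ν', hν'⟩
    by_cases h : (i : ℕ) = ν'
    · rw [if_pos h] at hν'
      have : i = ν' := Fin.ext h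
      rw [this, hinj hν']
    · rw [if_neg h] at hν'
      exact absurd hν'.symm (ne_conjugate τ hcm ν ν')
  · rintro rfl
    exact ⟨i, by simp⟩

/-- THE SPLIT AT `τ_ν`: the vertices containing `τ_ν` are exactly `0` and `ν + 1`. -/
theorem vertices_containing (hinj : Function.Injective τ) (hcm : IsCMType K (Set.range τ))
    (ν : Fin 3) : {i : Fin 4 | τ ν ∈ parityTetrahedron K τ i} = {0, ν.succ} := by
  ext i
  simp only [Set.mem_setOf_eq, Set.mem_insert_iff, Set.mem_singleton_iff]
  refine Fin.cases ?_ (fun j => ?_) i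
  · simp [mem_parityTetrahedron_zero τ ν]
  · rw [mem_parityTetrahedron_succ_iff τ hinj hcm j ν]
    simp only [Fin.succ_ne_zero, false_or, Fin.succ_inj]

/-- The conjugate `τ̄_ν` lies in the vertex `i` iff `τ_ν` does not (the complementary pair). -/
theorem conjugate_mem_parityTetrahedron_iff (hinj : Function.Injective τ)
    (hcm : IsCMType K (Set.range τ)) (i : Fin 4) (ν : Fin 3) :
    conjugate (τ ν) ∈ parityTetrahedron K τ i ↔ τ ν ∉ parityTetrahedron K τ i := by
  rcases (isWeilFace_parityTetrahedron K τ hinj hcm).1 i (τ ν) with ⟨h1, h2⟩ | ⟨h1, h2⟩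
  · exact ⟨fun h => absurd h h2, fun h => absurd h1 h⟩
  · exact ⟨fun _ => h2, fun _ => h1⟩

/-- THE SPLIT AT `τ̄_ν`: the vertices containing `τ̄_ν` are the two others. -/
theorem vertices_containing_conjugate (hinj : Function.Injective τ)
    (hcm : IsCMType K (Set.range τ)) (ν : Fin 3) :
    {i : Fin 4 | conjugate (τ ν) ∈ parityTetrahedron K τ i} = {0, ν.succ}ᶜ := by
  ext i
  simp only [Set.mem_setOf_eq, Set.mem_compl_iff]
  rw [conjugate_mem_parityTetrahedron_iff τ hinj hcm i ν]
  have := vertices_containing τ hinj hcm ν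
  constructor
  · intro h hi
    apply h
    rw [← this] at hi
    exact hi
  · intro h hi
    apply h
    rw [← this]
    exact hi

end Summit.Ventures.HodgeRepro2
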